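import Summits.ResolutionOfSingularities.ResolutionOfSingularities.Theorems.DescentPerfectToAll.Negative.WoundCriterion
import Literature.AlgebraicGeometry.Resolution.RegularBlowup
import Literature.AlgebraicGeometry.Resolution.BlowupsFlatBaseChange
import Literature.AlgebraicGeometry.Resolution.BlowupSequencesBaseChange
import Mathlib.AlgebraicGeometry.Morphisms.Flat
import Mathlib.AlgebraicGeometry.Morphisms.FiniteType
import HarnessLib

/-!
# `DescentPerfectToAll` — robust centres: the blow-up of a robust regular scheme along a robust regular centre is robust

Support lemma (OURS) for crux `stmt-ResolutionOfSingularities-0549`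
(`Summit.ResolutionOfSingularities.ResolutionOfSingularities.Theses.Descent.DescentPerfectToAll`):
the positive half of the ROBUST-CENTRE CALCULUS of `Cruxes/DescentPerfectToAll/STRATEGY-CENSUS.md`
§2.3 (b) — "`W` regular robust, `Z ⊂ W` regular ROBUST (`Z ⊗ k` regular) ⇒ `Bl_Z W` regular robust
(Bl commutes with the flat base change; blow-up of regular along regular)" — kernelised.

Setting: a field extension `k → K` (in the crux: one step `K = k(a^{1/p})` of the inseparable
tower, or the whole extension), a `k`-scheme `q : W → Spec k` locally of finite type, a blow-up
`π : W' → W` along an ideal sheaf `J` (universal property, tree `IsBlowup`), and the base changes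
`W_K = W ×_{Spec k} Spec K`, `W'_K`. "Robust" = regular after base change to `K`.

* `isRegular_pullback_comp_of_isBlowup` — **if `W_K` is regular and the base-changed centre
  `Z_K = V(J · 𝒪_{W_K})` is regular, then `W'_K` is regular.** Proof: `Spec K → Spec k` is flat, so
  is its base change `ι : W_K → W`; blow-ups commute with flat base change
  (`IsBlowup.pullback_snd_of_flat`, GW Prop. 13.91 (2)): `W' ×_W W_K → W_K` is the blow-up of `W_K`
  along `J · 𝒪_{W_K}`, whose source is regular (`IsBlowup.isRegular_of_isRegular_subscheme`: regular
  scheme, regular centre); and `W' ×_W W_K ≅ W'_K` (pullback pasting).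
* `isRegular_pullback_comp_of_isBlowup_of_forall_not_wound` — the same in WOUND language for one
  root `K = k(a^{1/p})` (`Negative/WoundCriterion.lean`): **blowing up an unwounded regular centre
  of an unwounded regular `k`-scheme gives an unwounded regular `k`-scheme** (with regular base
  change to `K`).

What it is for: together with the wound criterion (`Negative/WoundCriterion.lean`:
`W ×ₖ K` regular iff `W` regular and unwounded) this is the controllable half of the census's
design rule §2.3 (d) ("build the resolution of `X_m` by blowing up only robust centres"); the
uncontrollable half (the final strict transform must avoid the `p`-power directions) is where the
fixed-level strategy dies (`Negative/WoundInheritance.lean`, census §2.4). Nothing here bears on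
the crux or the summit as stated.

Sources: U. Görtz, T. Wedhorn, Algebraic Geometry I (2nd ed. 2020), Prop. 13.91 (2); Q. Liu,
Algebraic Geometry and Arithmetic Curves, Thm. 8.1.19; STRATEGY-CENSUS.md §2.3 (this tree).
-/

noncomputable section

open CategoryTheory CategoryTheory.Limits AlgebraicGeometry TopologicalSpace
open Literature.AlgebraicGeometry.Resolution

set_option linter.dupNamespace false -- mandated namespace `…ResolutionOfSingularities.ResolutionOfSingularities…` of this single-conjunct summit

namespace Summit.ResolutionOfSingularities.ResolutionOfSingularities.Theorems.RobustCentre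

variable {k K : Type} [Field k] [Field K] [Algebra k K]

/-- The base extension `Spec K → Spec k` of fields is flat. [folklore] -/
theorem flat_specMap_algebraMap_field :
    Flat (Spec.map (CommRingCat.ofHom (algebraMap k K))) := by
  rw [HasRingHomProperty.Spec_iff (P := @Flat), CommRingCat.hom_ofHom, RingHom.flat_algebraMap_iff]
  infer_instance

/-- **Robust regular centres give robust blow-ups** (STRATEGY-CENSUS §2.3 (b), kernel form). Let
`q : W → Spec k` be locally of finite type, `π : W' → W` a blow-up along `J` (`IsBlowup`), and
`k → K` a field extension with projection `ι : W_K = W ×_{Spec k} Spec K → W`. If `W_K` is regular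
and the base-changed centre `V(J · 𝒪_{W_K}) = (J.comap ι).subscheme` is regular, then
`W'_K = W' ×_{Spec k} Spec K` is regular. [cite: GortzWedhorn2020, Prop. 13.91 (2)] -/
theorem isRegular_pullback_comp_of_isBlowup {W W' : Scheme.{0}} (q : W ⟶ Spec (.of k))
    [LocallyOfFiniteType q] (π : W' ⟶ W) (J : W.IdealSheafData) (hπ : IsBlowup π J)
    (hWK : Scheme.IsRegular (pullback q (Spec.map (CommRingCat.ofHom (algebraMap k K)))))
    (hJK : Scheme.IsRegular
      (J.comap (pullback.fst q (Spec.map (CommRingCat.ofHom (algebraMap k K))))).subscheme) :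
    Scheme.IsRegular (pullback (π ≫ q) (Spec.map (CommRingCat.ofHom (algebraMap k K)))) := by
  set s : Spec (.of K) ⟶ Spec (.of k) := Spec.map (CommRingCat.ofHom (algebraMap k K)) with hs
  set ι := pullback.fst q s with hι
  haveI : Flat s := flat_specMap_algebraMap_field
  haveI : Flat ι := MorphismProperty.pullback_fst (P := @Flat) q s inferInstance
  -- `W_K` is locally Noetherian (locally of finite type over the field `K`)
  haveI : LocallyOfFiniteType (pullback.snd q s) :=
    MorphismProperty.pullback_snd (P := @LocallyOfFiniteType) q s inferInstance
  haveI : IsLocallyNoetherian (pullback q s) :=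
    LocallyOfFiniteType.isLocallyNoetherian (pullback.snd q s)
  -- blow-ups commute with the flat base change `ι`: `W' ×_W W_K → W_K` is the blow-up along `J·𝒪`
  have hbl : IsBlowup (pullback.snd π ι) (J.comap ι) := hπ.pullback_snd_of_flat ι
  have hreg : Scheme.IsRegular (pullback π ι) := hbl.isRegular_of_isRegular_subscheme hWK hJK
  -- pasting: `W' ×_W W_K ≅ W' ×_{Spec k} Spec K`
  exact hreg.of_iso (pullbackRightPullbackFstIso q s π).hom

open IsLocalRing in
/-- **Unwounded regular centres keep a regular scheme unwounded** (one-root form of the robust-centre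
calculus, STRATEGY-CENSUS §2.3 (b)–(d)). Let `K = k(α)`, `α^p = a ∉ k^p`, `q : W → Spec k` locally
of finite type with `W` regular and UNWOUNDED (at every point, `a - c^p ∉ 𝔪²` for all `c`), and
`π : W' → W` a blow-up along `J` whose centre `Z = V(J)` is regular and unwounded (as a `k`-scheme
via `Z ↪ W → Spec k`). Then `W' ×ₖ K` is regular and `W'` is (regular and) unwounded. (The wound
criterion turns "unwounded" into "regular base change" for `W` and for `Z`, the pulled-back
centre `V(J · 𝒪_{W_K})` is `Z ×ₖ K` (`isPullback_subschemeι_comap`), `isRegular_pullback_comp_of_isBlowup`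
applies, and the criterion read backwards on the regular `W'` gives unwoundedness.) [folklore] -/
theorem isRegular_pullback_comp_of_isBlowup_of_forall_not_wound {p : ℕ} [Fact p.Prime] [CharP k p]
    {a : k} {α : K} (ha : ∀ b : k, b ^ p ≠ a) (hα : α ^ p = algebraMap k K a)
    (hgen : IntermediateField.adjoin k {α} = ⊤) {W W' : Scheme.{0}} (q : W ⟶ Spec (.of k))
    [LocallyOfFiniteType q] (π : W' ⟶ W) (J : W.IdealSheafData) (hπ : IsBlowup π J)
    (hW : Scheme.IsRegular W)
    (hWun : ∀ (y : W) (c : W.presheaf.stalk y),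
      (W.presheaf.germ ⊤ y trivial).hom (q.appTop.hom ((Scheme.ΓSpecIso (.of k)).inv.hom a)) -
        c ^ p ∉ (maximalIdeal (W.presheaf.stalk y)) ^ 2)
    (hZ : Scheme.IsRegular J.subscheme)
    (hZun : ∀ (z : J.subscheme) (c : J.subscheme.presheaf.stalk z),
      (J.subscheme.presheaf.germ ⊤ z trivial).hom ((J.subschemeι ≫ q).appTop.hom
        ((Scheme.ΓSpecIso (.of k)).inv.hom a)) - c ^ p ∉ (maximalIdeal (J.subscheme.presheaf.stalk z)) ^ 2) :
    Scheme.IsRegular (pullback (π ≫ q) (Spec.map (CommRingCat.ofHom (algebraMap k K)))) ∧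
      ∀ (y : W') (c : W'.presheaf.stalk y),
        (W'.presheaf.germ ⊤ y trivial).hom ((π ≫ q).appTop.hom ((Scheme.ΓSpecIso (.of k)).inv.hom a)) -
          c ^ p ∉ (maximalIdeal (W'.presheaf.stalk y)) ^ 2 := by
  set s : Spec (.of K) ⟶ Spec (.of k) := Spec.map (CommRingCat.ofHom (algebraMap k K)) with hs
  -- `W_K` and `Z_K` are regular by the wound criterion
  have hWK : Scheme.IsRegular (pullback q s) :=
    (DescentPerfectToAll.Negative.isRegular_pullback_iff_forall_not_wound ha hα hgen q hW).mpr hWun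
  have hZK : Scheme.IsRegular (pullback (J.subschemeι ≫ q) s) :=
    (DescentPerfectToAll.Negative.isRegular_pullback_iff_forall_not_wound ha hα hgen
      (J.subschemeι ≫ q) hZ).mpr hZun
  -- the pulled-back centre `V(J · 𝒪_{W_K})` is `Z ×ₖ K`
  have HX : IsPullback (pullback.fst q s) (pullback.snd q s) q (specOfAlgebra k K) :=
    IsPullback.of_hasPullback q s
  have hJK : Scheme.IsRegular (J.comap (pullback.fst q s)).subscheme :=
    hZK.of_iso (isPullback_subschemeι_comap K q J HX).isoPullback.inv
  refine ⟨isRegular_pullback_comp_of_isBlowup q π J hπ hWK hJK, ?_⟩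
  -- `W'` is regular, and unwounded by the criterion read backwards
  haveI : IsLocallyNoetherian W := LocallyOfFiniteType.isLocallyNoetherian q
  have hW' : Scheme.IsRegular W' := hπ.isRegular_of_isRegular_subscheme hW hZ
  exact (DescentPerfectToAll.Negative.isRegular_pullback_iff_forall_not_wound ha hα hgen
    (π ≫ q) hW').mp (isRegular_pullback_comp_of_isBlowup q π J hπ hWK hJK)

end Summit.ResolutionOfSingularities.ResolutionOfSingularities.Theorems.RobustCentre

end
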